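import Summits.KontsevichZagierPeriods.KontsevichZagierPeriods.Theses.Grothendieck
import Summits.KontsevichZagierPeriods.KontsevichZagierPeriods.Theorems.MzvKernelInKZ.Negative.ShuffleFour

/-!
# KontsevichZagierPeriods / Grothendieck — `GpcZeta4Eq4zeta31` (stmt-KontsevichZagierPeriods-0275)

Route `KontsevichZagierPeriods/Grothendieck`, rank-2 crux stmt-KontsevichZagierPeriods-0275:

  `ζ(4) = 4ζ(3,1)` is KZ-accessible — the two 4-dimensional rational simplex representations
  `[Δ₄, ω₀ω₀ω₀ω₁]` and `[Δ₄, 4·ω₀ω₀ω₁ω₁]` on `{1 > t₀ > t₁ > t₂ > t₃ > 0}` are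
  `Literature.NumberTheory.Transcendental.KZ.Equivalent`, i.e. their difference lies in the additive
  subgroup `KZ.relations` generated by the Kontsevich–Zagier moves (domain additivity, integrand
  additivity, semialgebraic change of variables, Newton–Leibniz), with every intermediate an
  absolutely convergent rational integral.

## Proof

* COLLAPSE of the `∀ r r'` packaging (re-derived here in 20 lines; the crux pins the common domain
  and the two integrands only ON the domain): any representation with domain `Δ₄` whose integrand
  agrees on `Δ₄` with a word integrand differs from the canonical word representation
  `MzvKernelInKZ.Negative.wordRep` by a relation
  (`MzvKernelInKZ.Negative.of_sub_of_wordRep_mem_relations`: one integrand-additivity move with a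
  zero representation). Hence `[r] − [r'] ≡ [Δ₄, ω₀₀₀₁] − [Δ₄, 4·ω₀₀₁₁] = cFds4` modulo relations,
  `cFds4` being the typed finite-double-shuffle target of
  `Theorems/MzvKernelInKZ/Negative/WeightFour.lean`.
* `Summit.KontsevichZagierPeriods.MzvKernelInKZ.Negative.cFds4_mem_relations`
  (`Theorems/MzvKernelInKZ/Negative/ShuffleFour.lean`, landed): `cFds4 = cShuffle4 − cStuffle4` with
  both the weight-4 shuffle `[Δ₂,ω₀ω₁]·[Δ₂,ω₀ω₁] ≡ 2[Δ₄,ω₀₁₀₁] + 4[Δ₄,ω₀₀₁₁]` (six-cell dissection of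
  `Δ₂ × Δ₂` + coordinate permutations, `ShuffleCells.lean`) and the weight-4 stuffle
  `[Δ₂,ω₀ω₁]·[Δ₂,ω₀ω₁] ≡ 2[Δ₄,ω₀₁₀₁] + [Δ₄,ω₀₀₀₁]` (cubical charts + Soudères-type positive partial
  fractions + block swap, `StuffleFour.lean`) realised as move chains with absolutely convergent
  rational intermediates; the product representation cancels in the difference, so the value
  `ζ(2)²` is never used.

Hence the finite double shuffle `ζ(4) = 4ζ(3,1)` (Ihara–Kaneko–Zagier 2006, p. 3: shuffle minus
stuffle at `(2),(2)`) is a chain of Kontsevich–Zagier moves, unconditionally.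

This file deliberately does NOT import `Theorems/GpcZeta4Eq4zeta31/Negative/Core.lean` (whose
`crux_iff_target` is the same collapse): that file opens decls of route `FurushoPentagon`
(`Zeta4Calibration`, `StuffleInKZ`, `ShuffleIsDissection`) which were dropped from that route at its
rev 18 (2026-08-16), so the collapse is re-proved locally against `MzvKernelInKZ/Negative` only.

References: M. Kontsevich, D. Zagier, *Periods* (2001), §§1.1–1.2; K. Ihara, M. Kaneko, D. Zagier,
*Derivation and double shuffle relations for multiple zeta values*, Compositio Math. 142 (2006),
p. 3; D. Zagier, *Values of zeta functions and their applications* (1994), §9.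
-/

noncomputable section

namespace Summit.KontsevichZagierPeriods.Grothendieck

open Set
open Literature.NumberTheory.Transcendental
open Summit.KontsevichZagierPeriods.MzvKernelInKZ.Negative

/-- The first inlined integrand of the crux IS the word integrand `wordFun ω4 1` of `ω₀ω₀ω₀ω₁`
(everywhere, junk values at zero denominators included). [folklore] -/
theorem crux_integrand_eq_wordFun_ω4 (t : Fin 4 → ℝ) :
    1 / (t 0 * t 1 * t 2 * (1 - t 3)) = wordFun ω4 1 t := by
  simp only [wordFun, ω4, Fin.prod_univ_four, one_div, mul_inv, Rat.cast_one, one_mul,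
    Matrix.cons_val_zero, Matrix.cons_val_one, Matrix.cons_val]
  simp

/-- The second inlined integrand of the crux IS the word integrand `wordFun ω31 4` of
`4·ω₀ω₀ω₁ω₁` (everywhere). [folklore] -/
theorem crux_integrand'_eq_wordFun_ω31 (t : Fin 4 → ℝ) :
    4 / (t 0 * t 1 * (1 - t 2) * (1 - t 3)) = wordFun ω31 4 t := by
  simp only [wordFun, ω31, Fin.prod_univ_four, div_eq_mul_inv, mul_inv, one_mul]
  simp

/-- **Crux `GpcZeta4Eq4zeta31` (stmt-KontsevichZagierPeriods-0275), proved.** `ζ(4) = 4ζ(3,1)` is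
KZ-accessible: the simplex representations `[Δ₄, ω₀ω₀ω₀ω₁]` and `[Δ₄, 4·ω₀ω₀ω₁ω₁]` are
`KZ.Equivalent`. Proof: both given representations are congruent to the canonical word
representations `wordRep ω4 1`, `wordRep ω31 4` (one null integrand move each,
`of_sub_of_wordRep_mem_relations`), and `[Δ₄, ω₀₀₀₁] − [Δ₄, 4·ω₀₀₁₁] = cFds4 ∈ KZ.relations` is the
landed finite double shuffle move chain `MzvKernelInKZ.Negative.cFds4_mem_relations` (shuffle
dissection minus cubical stuffle, product term cancelling). [cite: IharaKanekoZagier2006, p. 3] -/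
theorem gpcZeta4Eq4zeta31_proof :
    Summit.KontsevichZagierPeriods.KontsevichZagierPeriods.Theses.Grothendieck.GpcZeta4Eq4zeta31 := by
  intro r r' hd hi hd' hi'
  have hr : r.domain = simplex 4 := by rw [hd, setOf_chain_eq_simplex]
  have hr' : r'.domain = simplex 4 := by rw [hd', hr]
  have h1 : KZ.of r - KZ.of (wordRep ω4 1 adm_ω4) ∈ KZ.relations :=
    of_sub_of_wordRep_mem_relations adm_ω4 r hr fun t ht =>
      (hi ht).trans (crux_integrand_eq_wordFun_ω4 t)
  have h2 : KZ.of r' - KZ.of (wordRep ω31 4 adm_ω31) ∈ KZ.relations :=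
    of_sub_of_wordRep_mem_relations adm_ω31 r' hr' fun t ht =>
      (hi' ht).trans (crux_integrand'_eq_wordFun_ω31 t)
  show KZ.of r - KZ.of r' ∈ KZ.relations
  have e : KZ.of r - KZ.of r' =
      (KZ.of r - KZ.of (wordRep ω4 1 adm_ω4)) - (KZ.of r' - KZ.of (wordRep ω31 4 adm_ω31)) +
        cFds4 := by
    simp only [cFds4]; abel
  rw [e]
  exact KZ.relations.add_mem (KZ.relations.sub_mem h1 h2) cFds4_mem_relations

end Summit.KontsevichZagierPeriods.Grothendieck

end
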